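import Summits.BirchSwinnertonDyer.BirchSwinnertonDyer.Theses.PrintCf2RubinValueTwo
import Literature.NumberTheory.EllipticCurves.DeShalit1987.LMeasureExistence
import HarnessLib

/-!
# Line `katz_measure_two` — skeleton v1 (LEAD bsd-line-cf2-p1 g17, prover-bsd-line-cf2-p1-g17-0, 2026-08-30) for the PRINT LEAF
# `PrintCf2RubinValueTwo.KatzDistributionsAtTwoPrint` (stmt-BirchSwinnertonDyer-24720) = S3a-KATZ `stub_katzDistributions_two` of the
# registered line `yager_twist_dictionary` (v14.6) of crux 20368 `PrintCf2.SplitBadTwoRankOneOfFacts`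

WHAT THIS FILE IS. The print leaf is typed on the `ℤ₂²`-QUOTIENT (`BoundedDistribution (padicIntSq 2) ℂ_[2]` with
`DeShalit1987.IsKatzDistribution₂`, one twist `λ` and one independent pair at a time). The construction lane of cell `bsd-print-cf2`
(widths cf2c-w4, cf2c-w7, -w2, -w3, -w5, -w7, -w8; ≈ 150 accepted files, 2026-08-28/30) builds de Shalit's measure ONE LEVEL UP, on the
Galois group: a `GroupDistribution` on `Γ_K` along a tower of open subgroups (`absRayAdicTower`, `rayAdicTower`), e.g. -w2 g23's
`EllipticUnitsGlobal.Discharged.exists_ellipticUnitsGlobalMeasure_of_principal_split` (de Shalit II.4.12 on `Γ_K`, p754582). The tree ALREADY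
proves the descent from that currency to the print leaf's currency for every algebraic twist and every independent pair:
`DeShalit1987.katzDistributions₂_of_lMeasures` (cf2c-w4 g3, `KatzDistributionFromLMeasureAlgebraic.lean`: align the tower, twist by Weil's
avatar of `λ`, push forward along `σ ↦ (κ₁σ, κ₂σ)`). So the leaf closes BY NAME from ONE statement in the lane's own currency —
`DeShalit1987.thmII414_exists_lMeasure` READ AT `p = 2` — and that statement is the single registered stub of this skeleton:

* `stub_lMeasure_two` — de Shalit II Thm. 4.14 (with 4.12 Remarks (i), (iii), (iv); 4.16 (49)–(50)) at the split prime `2` in MEASURE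
  CURRENCY: periods `Ω ≠ 0`, `δ² = ±d_K`, `Ω₂ ∈ R₀ˣ` chosen BEFORE the modulus, and for every finite `S ∌ v, v̄` a tower `𝒰` of open
  subgroups of `Γ_K` with `⋂ U_n ⊆ rayKer K 2 S` and an integral (`‖μ‖ ≤ 1`) distribution `μ` along it with
  `DeShalit1987.IsLMeasure ι v v̄ S Ω δ Ω₂ 𝒰 μ` (the integrals of the avatars of the Hecke characters of type `(−m, j)`, `0 ≤ j < m`,
  unramified outside `S ∪ {v̄}`, are de Shalit's values (49)–(50)).
* `KatzDistributionsAtTwoPrint_of` — the leaf BY NAME: `katzDistributions₂_of_lMeasures 2 stub_lMeasure_two` (definitional unfolding only).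

lean rc 0 expected, sorries = 1 = the stub. READING FOR THE LANE (memo `Cruxes/KatzDistributionsAtTwoPrint/LEAD-MEMO-KATZ-RANGE-g17.md`):
(1) the stub's range is `0 ≤ j < m`; every moment theorem of the lane is a `j = 0` statement (`∫ κ^{k+1} dμ`, `m = k + 1`), and the complex
side in flight (-w7 g13, II.3.5 (13)) is `j = 0, k ≥ 3`; the `j > 0` identities (de Shalit II.4.6 / 4.10–4.11: Katz's comparison of the
`p`-adic derivation with the Maass–Shimura operator at CM points) and `k ∈ {1, 2}` (Hecke's trick) are UNSTAFFED; (2) there is NO sound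
Prop-level cut of this stub into «`j = 0` first, `j > 0` later» that does not carry the CM period pair `⟨Ω, Ω₂⟩` as data: for every
`t ∈ κ_v(I_v)` the right-translate `μ(· h_t)` (`h_t ∈ I_v`, `κ_v(h_t) = t`) satisfies EVERY `(m, 0)` identity with `(Ω, t^{±1}Ω₂)` and NO
`(m, j)`, `j ≥ 1`, identity for any `δ` unless `t = ±1` — so a two-stub version waits for the planner's currency decision on the CM bridge
(cf2c-w4 g11 `B6-CM-BRIDGE-SPEC-w4g11.md` §3); (3) both consumers of the leaf inside crux 20368 — the main-conjecture clause (23300/24721: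
the IDEAL `(G₂)`) and the value formula (24034: the NORM `‖G₂(x, y)‖`) — are invariant under that `t`-ambiguity (`G₂ ↦ l(h_t)(1+T₁)^{a_t} G₂`,
a unit multiple), which is the planner-level option of re-basing route C on the `j = 0` range (memo §4).
No summit statement is proved by this seat; 24720 / 20368 NOT closed; BSD is not proved by any of this.

References: [deShalit1987] II Thm. 4.14 (36) (p. 71), II.4.12 + Remarks (p. 66–67), II.4.16 (49)–(50) (p. 76–77), II.4.17 (54) (p. 78);
[LiTianYanZhu2025] Thm. 7.1 (the `p = 2` consumer in print).
-/

set_option autoImplicit false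
set_option linter.dupNamespace false

noncomputable section

open scoped Classical
open NumberField IsDedekindDomain Field
open Literature.NumberTheory.GaloisRepresentations Literature.NumberTheory.EllipticCurves
open Literature.NumberTheory.EllipticCurves.DeShalit1987

namespace Summit.BirchSwinnertonDyer.BirchSwinnertonDyer.Cruxes.KatzDistributionsAtTwoPrint.KatzMeasureTwo

/-- **S-LMEAS — `stub_lMeasure_two` [CONTENT, L–XL; = `DeShalit1987.thmII414_exists_lMeasure` READ AT `p = 2`, binder for binder — the
construction lane's target in its own currency]**: de Shalit II Thm. 4.14 at the split prime `2` in measure currency. For `K` imaginary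
quadratic with `2 = v v̄` split and `v` induced by `ι : ℚ̄₂ ≃ ℂ`, there are periods `Ω ≠ 0`, `δ` (`δ² = ±d_K`), `Ω₂ ∈ R₀ˣ` such that for
every finite set `S ∌ v, v̄` of finite places (modulus `𝔣 = ∏_{w ∈ S} w^∞ · v̄^∞`) there is a tower `𝒰` of OPEN subgroups of `Γ_K` with
`⋂ U_n ⊆ rayKer K 2 S` (= `Gal(K̄/K(𝔣2^∞))`) and an INTEGRAL bounded distribution `μ` along it whose integrals of the `2`-adic avatars of the
Hecke characters `ε` of type `(−m, j)`, `0 ≤ j < m`, unramified outside `S ∪ {v̄}`, are de Shalit's values (49)–(50):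
`DeShalit1987.IsLMeasure ι v v̄ S Ω δ Ω₂ 𝒰 μ`. WHO BUILDS IT: the measure lane — elliptic units → relative Coleman series → one-`𝔓` measure
(cf2c-w4 g10 p747710) → `Γ_K` measure at one modulus (-w8 g9, -w2 g23 p754582, modulo the four de Shalit II.2.4/2.5 prints) → glue across
moduli (`hcompat`, -w8 g10) → moments = Coates–Wiles values (cf2c-w4 g11 p753136/p754768) → CM bridge II.4.9 (spec `B6-CM-BRIDGE-SPEC-w4g11.md`,
ingredient (i) cf2c-w4 g12) → Eisenstein numbers (-w7 g12) = partial Hecke `L`-values (II.3.5 (13), -w7 g13, `k ≥ 3`, `j = 0`) → (38) at `j = 0`;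
OPEN AND UNSTAFFED inside this stub: the `j > 0` identities (II.4.6/4.10–4.11, Katz's comparison) and `k ∈ {1, 2}` (Hecke's trick) — see the
module docstring (2)–(3) and the LEAD memo for why they cannot be split off as a separate Prop without the CM period pair.
[cite: deShalit1987, II Thm. 4.14 (36) (p. 71), II.4.12 with Remarks (i), (iii), (iv) (p. 66–67), II.4.16 (49)–(50) (p. 76–77), II.4.17 (p. 77–78)] -/
theorem stub_lMeasure_two :
    ∀ (K : Type) [Field K] [NumberField K], IsImaginaryQuadratic K →
      ∀ (ι : PadicAlgCl 2 ≃+* ℂ) (v vbar : HeightOneSpectrum (𝓞 K)),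
        ((2 : ℕ) : 𝓞 K) ∈ v.asIdeal → ((2 : ℕ) : 𝓞 K) ∈ vbar.asIdeal → vbar ≠ v →
        (∀ (w : InfinitePlace K) (k : 𝓞 K), k ∈ v.asIdeal ↔ ‖ι.symm (w.embedding (k : K))‖ < 1) →
      ∃ (Ω δ : ℂ) (Ωp : (unrIntegers 2)ˣ), Ω ≠ 0 ∧
        (δ ^ 2 = (NumberField.discr K : ℂ) ∨ δ ^ 2 = -(NumberField.discr K : ℂ)) ∧
        ∀ (S : Finset (HeightOneSpectrum (𝓞 K))), v ∉ S → vbar ∉ S →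
          ∃ (𝒰 : SubgroupTower (absoluteGaloisGroup K)) (μ : GroupDistribution 𝒰 ℂ_[2]),
            (∀ n, IsOpen (𝒰.U n : Set (absoluteGaloisGroup K))) ∧
            (⋂ n, (𝒰.U n : Set (absoluteGaloisGroup K))) ⊆ DeShalit1987.rayKer K 2 S ∧
            μ.bound ≤ 1 ∧
            DeShalit1987.IsLMeasure ι v vbar S Ω δ ((Ωp : unrIntegers 2) : ℂ_[2]) 𝒰 μ := by
  sorry

/-- **COMPOSITION (no `sorry` outside the stub): the print leaf BY NAME** — `DeShalit1987.katzDistributions₂_of_lMeasures 2` (cf2c-w4 g3: align the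
tower with the congruence levels of `(κ₁, κ₂)`, twist by Weil's avatar of the algebraic `λ`, push forward along `σ ↦ (κ₁σ, κ₂σ)`; bound `≤ ‖μ‖ ≤ 1`)
applied to `stub_lMeasure_two`; the leaf's text is the theorem's conclusion at `p = 2` verbatim.
[cite: deShalit1987, II Thm. 4.14 (p. 71), II.4.16 (49)–(50) (p. 76–77), II.4.17 (54) (p. 78)] -/
theorem KatzDistributionsAtTwoPrint_of :
    Summit.BirchSwinnertonDyer.BirchSwinnertonDyer.Theses.PrintCf2RubinValueTwo.KatzDistributionsAtTwoPrint := by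
  unfold Summit.BirchSwinnertonDyer.BirchSwinnertonDyer.Theses.PrintCf2RubinValueTwo.KatzDistributionsAtTwoPrint
  exact DeShalit1987.katzDistributions₂_of_lMeasures 2 stub_lMeasure_two

end Summit.BirchSwinnertonDyer.BirchSwinnertonDyer.Cruxes.KatzDistributionsAtTwoPrint.KatzMeasureTwo

end
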